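import Mathlib
import Summits.Ventures.PercRepro2.HCov
import Summits.Ventures.PercRepro2.HCovCubic
import Summits.Ventures.PercRepro2.TriDisagreement
import Summits.Ventures.PercRepro2.TriDisagreementPinned
import Summits.Ventures.PercRepro2.TypedSplit
import Summits.Ventures.PercRepro2.OneTypedEdge
import Summits.Ventures.PercRepro2.TypedSeries
import Summits.Ventures.PercRepro2.StarPattern
import Summits.Ventures.PercRepro2.StarIdentities
import Summits.Ventures.PercRepro2.StarDebt
import Summits.Ventures.PercRepro2.ChainCoeff
import Summits.Ventures.PercRepro2.StarChain
import Summits.Ventures.PercRepro2.StarPayment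
import Summits.Ventures.PercRepro2.StarPairs
import Summits.Ventures.PercRepro2.StarPairsTwo
import Summits.Ventures.PercRepro2.StarNPM
import Summits.Ventures.PercRepro2.StarTwin
import Summits.Ventures.PercRepro2.StarTwinMerge

/-!
# TvT is an inequality between typed counts of graphs (blind cell PercRepro2, p1 g12; the
graph-row reading of the `(2,2,2)` residual after NEG-108)

`Bone_T_eq_graph` writes the triple base `B(T₁)` as `N_(1,1,1)(G) − 2 Σ_p N(G; p) − 6 N(G − y)`
(typed counts of `G` and its one-edge-pinned minors) and `Btriangle_eq_typedCount_twin` writes the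
triangle base `B(△₁)` as a typed count of the twin-star graph `G⁺`. Hence

`TvT ↔ N_(1,1,1)(G) − 2 Σ_p N(G; p) − 6 N(G − y) ≤ N(G⁺; s₃, t₁ open; s₂, t₂, t₃ of type 1)`

(**`tvT_iff_graphs`**): the residual of the `(2,2,2)` hard step is a linear inequality among
typed counts of GRAPHS (unmarked vertices allowed) — no hyperedge, no one-rung object. With
`typedCount_222_nonneg_iff_triangle` the `(2,2,2)` star of `G` itself reads
`0 ≤ N_(2,2,2)(G) ↔ B(T₁) ≤ B(T₂) + B(△₁)`, where only `B(T₂)` is not yet a graph count.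
-/

namespace Summit.Ventures.PercRepro2

open CovForm CovForm.OneTyped CovForm.TypedRed

namespace StarPattern

section Graphs

variable {V : Type*} {E : Type*} [Fintype E] [DecidableEq E] {R : Type*} [Field R] [LinearOrder R]
  {ends : E → Sym2 V} {o a₁ a₂ a₃ b : V} {s₁ s₂ s₃ t₁ t₂ t₃ : E} {y y' u₁ u₂ u₃ : V}

/-- **TvT between graphs.** `G` has the star `s₁ s₂ s₃` at `y` in `F` (all of type `1`) and the
twin star `t₁ t₂ t₃` at `y'` outside `F`, closed in `z`; `F₀ = F − {s₁, s₂, s₃}`, `z₀ = z` with the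
`y`-star closed. Then `B(T₁) ≤ B(△₁)` iff
`N_(1,1,1)(G) − 2 Σ_p N(G; p) − 6 N(G − y) ≤ N(G⁺; s₃, t₁ open; s₂, t₂, t₃ of type 1)`. -/
theorem tvT_iff_graphs (F : Finset E) (z : Config E) (τ : E → ℕ)
    (W : TwinStar ends o a₁ a₂ a₃ b s₁ s₂ s₃ t₁ t₂ t₃ y y' u₁ u₂ u₃)
    (D : StarData ends o a₁ a₂ a₃ b s₁ s₂ s₃ y u₁ u₂ u₃ (((F.erase s₁).erase s₂).erase s₃)
      (Function.update (Function.update (Function.update z s₁ false) s₂ false) s₃ false))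
    (D' : StarData ends o a₁ a₂ a₃ b t₁ t₂ t₃ y' u₁ u₂ u₃ (((F.erase s₁).erase s₂).erase s₃)
      (Function.update (Function.update (Function.update z s₁ false) s₂ false) s₃ false))
    (hs₁ : s₁ ∈ F) (hs₂ : s₂ ∈ F) (hs₃ : s₃ ∈ F) (hτ₁ : τ s₁ = 1) (hτ₂ : τ s₂ = 1)
    (hτ₃ : τ s₃ = 1) (hw₁ : z t₁ = false) (hw₂ : z t₂ = false) (hw₃ : z t₃ = false) :
    TvT (R := R) ends o a₁ a₂ a₃ b s₁ s₂ s₃ (((F.erase s₁).erase s₂).erase s₃)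
        (Function.update (Function.update (Function.update z s₁ false) s₂ false) s₃ false) τ ↔
      typedCount F z τ (K3 ends o a₁ a₂ a₃ b : Config E → Config E → Config E → R) -
        2 * (typedCount (insert s₁ (((F.erase s₁).erase s₂).erase s₃))
            (Function.update (Function.update (Function.update (Function.update z s₁ false) s₂
              false) s₃ false) s₂ true) (Function.update τ s₁ 1) (K3 ends o a₁ a₂ a₃ b) +
          typedCount (insert s₁ (((F.erase s₁).erase s₂).erase s₃))
            (Function.update (Function.update (Function.update (Function.update z s₁ false) s₂
              false) s₃ false) s₃ true) (Function.update τ s₁ 1) (K3 ends o a₁ a₂ a₃ b) +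
          typedCount (insert s₂ (((F.erase s₁).erase s₂).erase s₃))
            (Function.update (Function.update (Function.update (Function.update z s₁ false) s₂
              false) s₃ false) s₃ true) (Function.update τ s₂ 1) (K3 ends o a₁ a₂ a₃ b)) -
        6 * typedCount (((F.erase s₁).erase s₂).erase s₃)
          (Function.update (Function.update (Function.update z s₁ false) s₂ false) s₃ false) τ
          (K3 ends o a₁ a₂ a₃ b) ≤
      typedCount (insert s₂ (insert t₂ (insert t₃ (((F.erase s₁).erase s₂).erase s₃))))
        (Function.update (Function.update (Function.update (Function.update (Function.update z s₁
          false) s₂ false) s₃ false) s₃ true) t₁ true)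
        (Function.update (Function.update (Function.update τ t₃ 1) t₂ 1) s₂ 1)
        (K3 ends o a₁ a₂ a₃ b) := by
  have hz₁ : Function.update (Function.update (Function.update z s₁ false) s₂ false) s₃ false s₁ =
      false := by
    rw [Function.update_of_ne D.h13, Function.update_of_ne D.h12, Function.update_self]
  have hz₂ : Function.update (Function.update (Function.update z s₁ false) s₂ false) s₃ false s₂ =
      false := by
    rw [Function.update_of_ne D.h23, Function.update_self]
  have hz₃ : Function.update (Function.update (Function.update z s₁ false) s₂ false) s₃ false s₃ =
      false := Function.update_self _ _ _
  have hw₁' : Function.update (Function.update (Function.update z s₁ false) s₂ false) s₃ false t₁ =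
      false := by
    rw [Function.update_of_ne W.T.c31.symm, Function.update_of_ne W.T.c21.symm,
      Function.update_of_ne W.T.c11.symm]; exact hw₁
  have hw₂' : Function.update (Function.update (Function.update z s₁ false) s₂ false) s₃ false t₂ =
      false := by
    rw [Function.update_of_ne W.T.c32.symm, Function.update_of_ne W.T.c22.symm,
      Function.update_of_ne W.T.c12.symm]; exact hw₂
  have hw₃' : Function.update (Function.update (Function.update z s₁ false) s₂ false) s₃ false t₃ =
      false := by
    rw [Function.update_of_ne W.T.c33.symm, Function.update_of_ne W.T.c23.symm,
      Function.update_of_ne W.T.c13.symm]; exact hw₃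
  rw [tvT_iff_twin W D D' τ hz₁ hz₂ hz₃ hw₁' hw₂' hw₃',
    Bone_T_eq_graph F z τ D hs₁ hs₂ hs₃ hτ₁ hτ₂ hτ₃]

end Graphs

end StarPattern

end Summit.Ventures.PercRepro2
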